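import Mathlib
import HarnessLib.Audit
import Summits.PneNP.PneNP.Theorems.PstarCrossCaseU2Clean

/-!
# The blind free CROSS gate, regime P with a real (EQ) chord (node N2): the second constraint touches no private tree edge; the clean first-constraint rows are empty (O2 / E1; prover-1 g22)

FRONTIER range-avoidance ladder, rung F-N3 (`stmt-PneNP-19007`), cell `pnp-ideate`; restricted-model proof complexity — nothing here bears on `P` versus `NP`.

Node N2 (`PstarCrossNodes.CrossCasePChords`): regime P with a real chord `e ∈ (N.erase e_q).erase e_p`.  `PstarCrossCaseP.forced_cases_real` puts `e` in row
(EQ) `Q_{D e} = q_{(1,0)} + κ`, (EXC) or (NOR).  In row (EQ) the second constraint IS the path sum of `D e` up to a constant, i.e. the clean row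
`q_{(1,0)} + κ' = u_e` of `PstarCrossCaseU2Clean.untouched_of_clean`:

* `untouched₂_of_EQ` — an (EQ) real chord makes `w₂` read no AND variable of any private tree edge;
* `false_of_EQ_clean` — if moreover `q_{(0,1)}` is in a clean row (`q_{(0,1)} + κ₁ ∈ {0, u_e}`) and `#N < #(J₀ ∖ N) + 3`, contradiction (TOUCH + budget).
The first-coordinate rows come from `Z(q_{(1,0)}) ⊆ {q_{(0,1)} = 1 + σ₁}` (`PstarCrossCaseP.qDir01_of_q`) and `PstarRankRigidityFour.classification` against
`u_e` (rank `≥ 4`); the product rows and the bound on `#N` (the other real chords are (EXC) bundles of `D e`) are the residual of N2.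
-/

set_option linter.dupNamespace false -- `Summit.PneNP.PneNP.…`: summit = sub-problem name (D-0017 single-conjunct layout)

open Finset Module Literature.Computability.Complexity
open Summit.PneNP.PneNP.Theorems.PstarTyped (Typed)
open Summit.PneNP.PneNP.Theorems.PstarSALevel (varSet BoundaryExpanding SimpleOverlap)
open Summit.PneNP.PneNP.Theorems.PstarProductRank (qform polar)
open Summit.PneNP.PneNP.Theorems.PstarReadSumset (V2)
open Summit.PneNP.PneNP.Theorems.PstarChordSystem (ChordSystem)
open Summit.PneNP.PneNP.Theorems.PstarChordBridgeTools
open Summit.PneNP.PneNP.Theorems.PstarChordBridge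
open Summit.PneNP.PneNP.Theorems.PstarChordBridgeForcing (freeMon gam sys_u_eq)
open Summit.PneNP.PneNP.Theorems.PstarChordBridgeBasis (qDir polarDir)
open Summit.PneNP.PneNP.Theorems.PstarGateCasePUnitsTouch (not_mem_C_of_qDir polarDir_single)
open Summit.PneNP.PneNP.Theorems.PstarCrossData (CrossData)
open Summit.PneNP.PneNP.Theorems.PstarCrossSystem
open Summit.PneNP.PneNP.Theorems.PstarCrossCorner (PrivEdge)
open Summit.PneNP.PneNP.Theorems.PstarCrossCaseP (qDir10_eq)
open Summit.PneNP.PneNP.Theorems.PstarCrossCaseU2Clean (untouched_of_clean false_of_untouched)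

namespace Summit.PneNP.PneNP.Theorems.PstarCrossCasePChordsEQ

variable {n m : ℕ}

section

variable (I : LocalMap 4 n m) {r : ℕ} {B : BridgeData n m} {e_p e_q g₀ : Fin m}

/-- An (EQ) chord puts `q_{(1,0)}` in the clean row `q_{(1,0)} + (κ + γ_e) = u_e`. -/
theorem row_of_EQ (B : BridgeData n m) (e_p e_q : Fin m) {e : Fin m} {κ : ZMod 2}
    (hEQ : ∀ x, qform (B.D e) (fun j => I.vars j 2) (fun j => I.vars j 3) x = (((sys I B).F x).2 + (sys I B).t.2) + κ) :
    ∀ x, qDir I B (1, 0) x + (κ + gam B e) = (sys I B).u e x := by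
  intro x
  rw [qDir10_eq I B e_p e_q, ChordSystem.vsys_F, ChordSystem.vsys_t, sys_u_eq, hEQ]
  ring

/-- **Regime P with a real (EQ) chord: the second constraint reads no private tree edge.** -/
theorem untouched₂_of_EQ (hI : I.IsPure xorAndPred) (hT : Typed I) (hS : SimpleOverlap I) (hD : CrossData I r B e_p e_q g₀) {e : Fin m} (he : e ∈ B.N)
    {κ : ZMod 2} (hEQ : ∀ x, qform (B.D e) (fun j => I.vars j 2) (fun j => I.vars j 3) x = (((sys I B).F x).2 + (sys I B).t.2) + κ)
    {π : Fin m} (hπ : PrivEdge I B π) :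
    (I.vars π 2 ∉ B.C₂ ∧ I.vars π 3 ∉ B.C₂) ∧
      ∀ g ∈ B.G₂, I.vars g 2 ≠ I.vars π 2 ∧ I.vars g 3 ≠ I.vars π 2 ∧ I.vars g 2 ≠ I.vars π 3 ∧ I.vars g 3 ≠ I.vars π 3 := by
  have hW := hD.wf
  have hGfree : ∀ g ∈ B.G₂, ¬ (I.vars g 2 ∈ privs I B.N ∨ I.vars g 3 ∈ privs I B.N) := by
    intro g hg hor
    rcases hor with h2 | h3
    · exact ((hD.hun _ h2).2 g hg).1 rfl
    · exact ((hD.hun _ h3).2 g hg).2 rfl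
  exact untouched_of_clean I hI hS hD he (mv := (1, 0)) hW.hT₂ hD.disj₂ hGfree
    (fun π s hπ hs h => (not_mem_C_of_qDir I hI hT hW hπ hs).2 h) (fun c d => by rw [polarDir_single]; simp)
    (Or.inr (row_of_EQ I B e_p e_q hEQ)) hπ

/-- **Regime P with a real (EQ) chord and a clean first-constraint row**: contradiction as soon as `#N < #(J₀ ∖ N) + 3`. -/
theorem false_of_EQ_clean (hI : I.IsPure xorAndPred) (hT : Typed I) (hS : SimpleOverlap I) (hB : BoundaryExpanding r I)
    (hD : CrossData I r B e_p e_q g₀) {e : Fin m} (he : e ∈ B.N)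
    {κ : ZMod 2} (hEQ : ∀ x, qform (B.D e) (fun j => I.vars j 2) (fun j => I.vars j 3) x = (((sys I B).F x).2 + (sys I B).t.2) + κ)
    {κ₁ : ZMod 2} (h01 : (∀ x, qDir I B (0, 1) x + κ₁ = 0) ∨ (∀ x, qDir I B (0, 1) x + κ₁ = (sys I B).u e x))
    (hlt : B.N.card < (B.J₀ \ B.N).card + 3) : False := by
  have hW := hD.wf
  have hGfree : ∀ g ∈ B.G₁, ¬ (I.vars g 2 ∈ privs I B.N ∨ I.vars g 3 ∈ privs I B.N) := by
    intro g hg hor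
    rcases hor with h2 | h3
    · exact ((hD.hun _ h2).1 g hg).1 rfl
    · exact ((hD.hun _ h3).1 g hg).2 rfl
  have hd₁ : Disjoint B.G₁ B.J₀ := Finset.disjoint_of_subset_left (subset_insert g₀ B.G₁) hD.disj₁
  refine false_of_untouched I hI hB hD hlt fun π hπ => ?_
  obtain ⟨hC₁, hG₁⟩ := untouched_of_clean I hI hS hD he (mv := (0, 1)) hW.hT₁ hd₁ hGfree
    (fun π s hπ hs h => (not_mem_C_of_qDir I hI hT hW hπ hs).1 h) (fun c d => by rw [polarDir_single]; simp) h01 hπ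
  obtain ⟨hC₂, hG₂⟩ := untouched₂_of_EQ I hI hT hS hD he hEQ hπ
  exact ⟨hC₁, hC₂, hG₁, hG₂⟩

end

end Summit.PneNP.PneNP.Theorems.PstarCrossCasePChordsEQ
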